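import Literature.Computability.Cryptography.RegevSamplerArith
import HarnessLib

/-!
# Regev 2009, Lemma 3.14 in machine form: the classical decoder of the measured frequencies

Topic `Computability/Cryptography` (family `pqc`), grouping namespace `Regev2009.SamplerDecode`. The
last step of Regev's sampler (J. ACM 56 (2009), art. 34, Lemma 3.14; author's version
arXiv:2401.03703, p. 20): after the quantum Fourier transform the second register is measured in a
frequency `w ∈ (ℤ/R)ⁿ`, which names the point `Σⱼ wⱼ bⱼ` of the lattice modulo `R·L`; since the sample
has norm `< √n < λ₁(RL)/2` it is the unique short point of its coset, and — `R` being large against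
`√n · max ‖b∨ⱼ‖` — that point is read off COORDINATEWISE: its `j`-th coordinate is the centred
representative `valMinAbs(wⱼ)` of `wⱼ`. The register analysis in this tree (`QPart.law_bound_of_basis`,
`Algebra/EuclideanLattices/RegevQuantumPartLaw.lean`) takes the decoder as a hypothesis

  `hdec : ∀ w, ∀ x ∈ L, ‖Σⱼ val(wⱼ) bⱼ + R x‖ < √n → dec w = Σⱼ val(wⱼ) bⱼ + R x`;

this file discharges it for the rescaled instance lattice `L_t = t⁻¹ L(B)` (basis `t⁻¹ bⱼ`, stated here
with the explicit vectors `t⁻¹ • I.vec j` and the membership `t • x ∈ L(B)`, so that only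
`RegevSamplerArith` is imported) with the explicit decoder
`dec w = t⁻¹ Σⱼ valMinAbs(wⱼ) bⱼ` (`ZMod.valMinAbs` = Mathlib's centred representative):

* `valMinAbs_eq_of_two_mul_abs_lt` — an integer `val(a) + R z` of absolute value `< R/2` IS `valMinAbs a`;
* `inner_sum_smul_vec_dualVec` (`⟪Σ cᵢ bᵢ, b∨ⱼ⟫ = cⱼ`), `exists_intCoords_of_mem` (points of `L(B)` have
  integer coordinates along `(bⱼ)`);
* **`dec_eq_of_norm_lt`** — if `2|t| ρ ‖b∨ⱼ‖ ≤ R` for all `j`, then for every `w` and every `x` with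
  `t x ∈ L(B)`, `‖Σⱼ val(wⱼ) t⁻¹bⱼ + R x‖ < ρ ⇒ dec w = Σⱼ val(wⱼ) t⁻¹bⱼ + R x`.

In the reduction the output is reported in the coordinates `(valMinAbs(wⱼ))ⱼ` of the basis `B` — the factor
`t⁻¹` lives only in the analysis. Everything is proved; definitions have bodies; no named fact is introduced.

## References

* O. Regev, *On lattices, learning with errors, random linear codes, and cryptography*, J. ACM 56
  (2009), art. 34; author's version arXiv:2401.03703: Lemma 3.14 (proof: "λ₁(RL) > √n … we obtain
  a sample"), p. 20 [Regev2009].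
* D. Micciancio, S. Goldwasser, *Complexity of Lattice Problems*, Kluwer 2002, Ch. 1 §1.1 (coordinates
  along a basis via the dual basis) [MicciancioGoldwasser2002].
-/

noncomputable section

namespace Literature.Computability.Cryptography

namespace Regev2009

namespace SamplerDecode

open Literature.Algebra.EuclideanLattices Peikert2009 Finset SamplerArith
open scoped InnerProductSpace

/-! ### The centred representative -/

/-- **Unique short representative**: an integer `val(a) + R z` with `2|val(a) + R z| < R` is the
centred representative `a.valMinAbs` (Mathlib). [folklore] -/
theorem valMinAbs_eq_of_two_mul_abs_lt (R : ℕ) [NeZero R] (a : ZMod R) (z : ℤ)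
    (h : 2 * |(a.val : ℤ) + R * z| < R) : (a.val : ℤ) + R * z = a.valMinAbs := by
  symm
  rw [ZMod.valMinAbs_spec]
  refine ⟨?_, ?_, ?_⟩
  · push_cast
    rw [ZMod.natCast_zmod_val, ZMod.natCast_self, zero_mul, add_zero]
  · have := neg_abs_le ((a.val : ℤ) + R * z); omega
  · have := le_abs_self ((a.val : ℤ) + R * z); omega

/-! ### Coordinates along `B` -/

variable (I : LatticeInstance)

/-- `⟪Σᵢ cᵢ bᵢ, b∨ⱼ⟫ = cⱼ`. [cite: MicciancioGoldwasser2002, Ch. 1 §1.1] -/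
theorem inner_sum_smul_vec_dualVec [hZ : IsZLattice ℝ I.lattice] (c : Fin I.n → ℝ) (j : Fin I.n) :
    ⟪∑ i, c i • I.vec i, dualVec I j⟫_ℝ = c j := by
  rw [sum_inner]
  simp_rw [real_inner_smul_left, inner_vec_dualVec I, mul_ite, mul_one, mul_zero]
  rw [sum_ite_eq' univ j, if_pos (mem_univ j)]

/-- Points of `L(B)` have integer coordinates along `(bⱼ)`. [folklore] -/
theorem exists_intCoords_of_mem {y : EuclideanSpace ℝ (Fin I.n)} (hy : y ∈ I.lattice) :
    ∃ z : Fin I.n → ℤ, y = ∑ i, (z i : ℝ) • I.vec i := by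
  rw [LatticeInstance.lattice, Submodule.mem_span_range_iff_exists_fun] at hy
  obtain ⟨z, hz⟩ := hy
  refine ⟨z, ?_⟩
  rw [← hz]
  exact sum_congr rfl fun i _ => (Int.cast_smul_eq_zsmul ℝ (z i) (I.vec i)).symm

/-! ### The decoder -/

/-- **The decoder** `dec w = t⁻¹ Σⱼ valMinAbs(wⱼ) bⱼ` (the short point of the coset named by the measured
frequency, in the units of `L_t = t⁻¹ L(B)`). [cite: Regev2009, Lemma 3.14 (proof, last step)] -/
def dec (t : ℝ) (R : ℕ) (w : Fin I.n → ZMod R) : EuclideanSpace ℝ (Fin I.n) :=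
  t⁻¹ • ∑ j, ((w j).valMinAbs : ℝ) • I.vec j

/-- **The decoder is correct on short points.** If `2|t|ρ‖b∨ⱼ‖ ≤ R` for every `j`, then for every
frequency `w` and every `x` with `t x ∈ L(B)` (i.e. `x ∈ L_t`):
`‖Σⱼ val(wⱼ) t⁻¹bⱼ + R x‖ < ρ ⇒ dec w = Σⱼ val(wⱼ) t⁻¹bⱼ + R x` — the hypothesis `hdec` of
`QPart.law_bound_of_basis` for `L_t` (`ρ = √n`). [cite: Regev2009, Lemma 3.14 (proof: "λ₁(RL) > √n")] -/
theorem dec_eq_of_norm_lt [hZ : IsZLattice ℝ I.lattice] {t : ℝ} (ht : t ≠ 0) {R : ℕ} [NeZero R] {ρ : ℝ}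
    (hR : ∀ j, 2 * |t| * ρ * ‖dualVec I j‖ ≤ R) (w : Fin I.n → ZMod R) {x : EuclideanSpace ℝ (Fin I.n)}
    (hx : t • x ∈ I.lattice)
    (hv : ‖∑ j, ((w j).val : ℝ) • (t⁻¹ • I.vec j) + (R : ℝ) • x‖ < ρ) :
    dec I t R w = ∑ j, ((w j).val : ℝ) • (t⁻¹ • I.vec j) + (R : ℝ) • x := by
  obtain ⟨z, hz⟩ := exists_intCoords_of_mem I hx
  -- the point in the units of `L(B)`
  set u : EuclideanSpace ℝ (Fin I.n) := ∑ i, (((w i).val : ℝ) + R * z i) • I.vec i with hu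
  have hx' : x = t⁻¹ • ∑ i, (z i : ℝ) • I.vec i := by
    rw [← hz, smul_smul, inv_mul_cancel₀ ht, one_smul]
  have hvu : ∑ j, ((w j).val : ℝ) • (t⁻¹ • I.vec j) + (R : ℝ) • x = t⁻¹ • u := by
    rw [hu, hx', smul_sum, smul_sum, ← sum_add_distrib, smul_sum]
    refine sum_congr rfl fun i _ => ?_
    module
  -- each coordinate of `u` is small
  have hcoord : ∀ j, ((w j).val : ℤ) + R * z j = (w j).valMinAbs := by
    intro j
    apply valMinAbs_eq_of_two_mul_abs_lt
    have hin : ⟪u, dualVec I j⟫_ℝ = ((w j).val : ℝ) + R * z j := inner_sum_smul_vec_dualVec I _ j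
    have hnu : ‖u‖ = |t| * ‖∑ j, ((w j).val : ℝ) • (t⁻¹ • I.vec j) + (R : ℝ) • x‖ := by
      rw [hvu, norm_smul, Real.norm_eq_abs, abs_inv, ← mul_assoc, mul_inv_cancel₀ (abs_ne_zero.2 ht), one_mul]
    have hb0 : 0 < ‖dualVec I j‖ := norm_pos_iff.2 ((dualVec I).ne_zero j)
    have h1 : |((w j).val : ℝ) + R * z j| ≤ ‖u‖ * ‖dualVec I j‖ := by
      rw [← hin]; exact abs_real_inner_le_norm _ _
    have h2 : ‖u‖ * ‖dualVec I j‖ < |t| * ρ * ‖dualVec I j‖ := by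
      rw [hnu, mul_assoc, mul_assoc]
      exact mul_lt_mul_of_pos_left (mul_lt_mul_of_pos_right hv hb0) (abs_pos.2 ht)
    have h3 : 2 * |((w j).val : ℝ) + R * z j| < R := by
      have := hR j; nlinarith [abs_nonneg (((w j).val : ℝ) + R * z j)]
    have h4 : ((2 * |((w j).val : ℤ) + R * z j| : ℤ) : ℝ) < (R : ℝ) := by
      push_cast
      exact h3
    exact_mod_cast h4
  rw [hvu, dec]
  congr 1
  refine sum_congr rfl fun j _ => ?_
  rw [← hcoord j]
  push_cast
  rfl

end SamplerDecode

end Regev2009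

end Literature.Computability.Cryptography

end
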